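import Literature.MathematicalPhysics.KineticTheory.CollisionTubeMeanRung0
import Literature.MathematicalPhysics.KineticTheory.HardSphereCanonicalPairLowerBound
import Literature.MathematicalPhysics.KineticTheory.CollisionFluxUpperBound
import Literature.MathematicalPhysics.KineticTheory.EvenStatTruncationBound
import HarnessLib

/-!
# The collision-tube functional at rung 0, pair level: a LOWER bound on the tube mean of one ordered
# pair for every nonnegative mark, without the contact theorem

Topic `Literature/MathematicalPhysics/KineticTheory` (kind proof; one-sided companion of
`CollisionTubePairMean.pair_tubeMark_mean`; the static input of every collision-rate FLOOR at rung 0 —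
crux `JParityClosure.RateFloor`, stmt-AtomisticToContinuum-13080, line `Sketch`, rung-0 stub
`stub_staticOpacityFloorRung0` — where the two-sided contact hypothesis of the Enskog closure is neither
available nor needed).

Fix constant profiles `(a, u, θ)`, `N + 1` spheres of diameter `ε = ε_N = hsDiameter σ N` on `𝕋³`, the
rung-0 local Gibbs law `G_N = zipConfig_# (P_N ⊗ ⊗ᵢ N(u,θ))` (`HardSphereUniformGas`), an ordered pair
`i ≠ j`, a flight-time window `κ ≥ 0` and a measurable mark `Ξ ≥ 0`, `|Ξ| ≤ C`, vanishing at relative speed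
`‖v − v'‖ ≥ 2L` (a speed cutoff; every bounded nonnegative mark times a continuous cutoff `ψ_L(v − v')` is of
this form).  The pair's contribution to the collision-tube functional is
`χ(xᵢ) · pairTubeMark ε κ Ξ i j x v = χ(xᵢ) · tubeMark κ Ξ (ε⁻¹ reprSym (xᵢ − xⱼ)) vᵢ vⱼ` (`CollisionTubePairMean`).

* `mul_setIntegral_le_setIntegral_of_forall_le` — one-sided transfer: `c μ(S) ≤ ν(S)` for all measurable
  `S ⊆ T` gives `c ∫_T g dμ ≤ ∫_T g dν` for bounded measurable `g ≥ 0`;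
* `integral_tubeMark_ge` — if the law of `reprSym (xᵢ − xⱼ)` under a finite measure `P` on positions
  dominates `c ·` Lebesgue on the rescaled shell `1 < ‖q‖ ≤ 1 + δ` (`2Lκ ≤ δ`), then for all velocities
  `c κ Θ Ξ v v' ≤ ∫ tubeMark κ Ξ (ε⁻¹ reprSym (xᵢ − xⱼ)) v v' dP` (`Θ = sphereMark`; the strict tube of a pair
  of relative speed `< 2L` lies in the shell, `∫ tubeMark dq = κ Θ Ξ v v'`, and the mark vanishes at larger
  relative speed);
* `posGibbs_rescaledPairEvent_ge` — the hypothesis of the previous item for the canonical hard-sphere measure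
  with `c = (1 − 16λ) ε³`, `λ = v₁σ³` (`HardSphereCanonicalPairLowerBound.posGibbs_pairEvent_ge` transported to
  the rescaled relative position: `reprSym` is measure preserving onto the symmetric cube, which contains the
  ball of radius `ε(1 + δ) < 1/2`, and Lebesgue measure scales by `ε³`);
* `abs_sphereMark_le_of_speedCutoff` — `|Θ Ξ v w| ≤ C · 2L · |S²|`;
* `pair_tubeMark_mean_ge` — **the pair tube mean is at least `(1 − 16λ)` times the ideal one**:
  `(∫χ) · (1 − 16λ) ε³ κ Θ̄_Ξ ≤ E_{G_N}[χ(xᵢ) pairTubeMark ε κ Ξ i j]`, `Θ̄_Ξ = ∫∫ Θ Ξ (v, v') M(v) M(v') dv dv'`,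
  for continuous `χ ≥ 0`, uniformly in `N`, `κ`, `L` with `ε(1 + 2Lκ) < 1/2`;
* `exists_pair_tubeMark_mean_ge_half` — in the crux's parametrisation: for `0 < σ < σ₀` the pair tube mean is
  at least HALF the ideal one.

Proof of the last two items: disintegrate (`integral_localGibbsLaw_mul_shiftInvariant`: product structure,
Fubini, translation invariance of `P_N` factors out `∫χ`), bound the position average for fixed velocities
by `integral_tubeMark_ge` + `posGibbs_rescaledPairEvent_ge`, integrate the velocities
(`integral_pi_pair_gauss`).  Only monotonicity of the hard-core probability and the insertion ratios enter
(through `posGibbs_pairEvent_ge`); no cluster expansion and no contact theorem.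

References: D. Ruelle, *Statistical Mechanics: Rigorous Results* (1969) §4.2 [Ruelle1969]; C. Cercignani,
R. Illner, M. Pulvirenti (1994) §2.2 [CIPDiluteGases1994]; H. Spohn (1991) Part I §2.3 [Spohn1991].
-/

noncomputable section

open MeasureTheory ProbabilityTheory Set Filter Topology Function
open scoped ENNReal InnerProductSpace BigOperators Pointwise

namespace Literature.MathematicalPhysics.KineticTheory

open Literature.Analysis.FluidPDE StatisticalMechanics

/-! ## One-sided transfer of set-wise lower bounds to integrals -/

section Comparison

variable {α : Type*} [MeasurableSpace α]

/-- **One-sided transfer, lower form.**  If `c μ(S) ≤ ν(S)` for all measurable `S ⊆ T` (`T` of finite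
`ν`- and `μ`-measure), then `c ∫_T g dμ ≤ ∫_T g dν` for every bounded measurable `g ≥ 0` (no sign
assumption on `c`: for `c ≤ 0` the left side is nonpositive). [folklore] -/
theorem mul_setIntegral_le_setIntegral_of_forall_le {ν μ : Measure α} {T : Set α} (hT : MeasurableSet T)
    (hνT : ν T ≠ ∞) (hμT : μ T ≠ ∞) {c : ℝ}
    (h : ∀ S, MeasurableSet S → S ⊆ T → c * μ.real S ≤ ν.real S)
    {g : α → ℝ} (hg : Measurable g) (hg0 : ∀ x, 0 ≤ g x) {B : ℝ} (hB : ∀ x, g x ≤ B) :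
    c * ∫ x in T, g x ∂μ ≤ ∫ x in T, g x ∂ν := by
  have hgb : ∀ x, ‖g x‖ ≤ B := fun x => by rw [Real.norm_eq_abs, abs_of_nonneg (hg0 x)]; exact hB x
  have hgiν : Integrable g (ν.restrict T) :=
    Measure.integrableOn_of_bounded hνT hg.aestronglyMeasurable (ae_of_all _ hgb)
  have hIμ0 : 0 ≤ ∫ x in T, g x ∂μ := integral_nonneg hg0
  have hIν0 : 0 ≤ ∫ x in T, g x ∂ν := integral_nonneg hg0
  by_cases hc : c ≤ 0
  · exact (mul_nonpos_of_nonpos_of_nonneg hc hIμ0).trans hIν0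
  push Not at hc
  have h' : ∫ x in T, g x ∂μ ≤ c⁻¹ * ∫ x in T, g x ∂ν :=
    setIntegral_le_mul_setIntegral_of_forall_le hT hμT hνT (inv_nonneg.2 hc.le) (fun S hS hST => by
      rw [le_inv_mul_iff₀ hc]; exact h S hS hST) hg0 hgiν
  have := mul_le_mul_of_nonneg_left h' hc.le
  rwa [← mul_assoc, mul_inv_cancel₀ hc.ne', one_mul] at this

end Comparison

/-! ## Marks with a speed cutoff: the sphere-integrated mark is bounded and nonnegative -/

/-- The sphere-integrated mark of a nonnegative mark is nonnegative. [folklore] -/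
theorem sphereMark_nonneg {Ξ : V3 × V3 × V3 → ℝ} (hΞ0 : ∀ p, 0 ≤ Ξ p) (v w : V3) : 0 ≤ sphereMark Ξ v w :=
  integral_nonneg fun ω => mul_nonneg (hΞ0 _) (hardSphereKernel_nonneg_le v w ω).1

/-- **A mark with a speed cutoff has a bounded sphere integral**: if `|Ξ| ≤ C` and `Ξ(·, v, v') = 0`
whenever `2L ≤ ‖v − v'‖` (`L ≥ 0`), then `|Θ Ξ v w| ≤ C · 2L · |S²|` (the kernel is `≤ ‖w − v‖ < 2L` where the
mark is nonzero). [folklore] -/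
theorem abs_sphereMark_le_of_speedCutoff {Ξ : V3 × V3 × V3 → ℝ} {C L : ℝ} (hΞC : ∀ p, |Ξ p| ≤ C) (hL : 0 ≤ L)
    (hΞL : ∀ m v v' : V3, 2 * L ≤ ‖v - v'‖ → Ξ (m, v, v') = 0) (v w : V3) :
    |sphereMark Ξ v w| ≤ C * (2 * L) * (sphereMeasure : Measure (Metric.sphere (0 : V3) 1)).real univ := by
  haveI := isFiniteMeasure_sphereMeasure (E := V3)
  have hC0 : 0 ≤ C := (abs_nonneg _).trans (hΞC (0, 0, 0))
  have hpt : ∀ ω : Metric.sphere (0 : V3) 1, ‖Ξ ((ω : V3), v, w) * hardSphereKernel (w, v) ω‖ ≤ C * (2 * L) := by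
    intro ω
    obtain ⟨hk0, hk1⟩ := hardSphereKernel_nonneg_le v w ω
    rw [Real.norm_eq_abs, abs_mul, abs_of_nonneg hk0]
    by_cases h : ‖v - w‖ < 2 * L
    · rw [norm_sub_rev] at h
      exact mul_le_mul (hΞC _) (hk1.trans h.le) hk0 hC0
    · push Not at h
      rw [hΞL _ v w h, abs_zero, zero_mul]
      positivity
  have h := norm_integral_le_of_norm_le_const (μ := (sphereMeasure : Measure (Metric.sphere (0 : V3) 1)))
    (f := fun ω : Metric.sphere (0 : V3) 1 => Ξ ((ω : V3), v, w) * hardSphereKernel (w, v) ω)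
    (C := C * (2 * L)) (Eventually.of_forall hpt)
  simpa only [Real.norm_eq_abs, sphereMark] using h

/-! ## The configurational average of the tube mark of one pair: lower bound -/

/-- **Lower bound for the configurational average of the tube mark of one pair.**  If the law of
`reprSym (xᵢ − xⱼ)` under a finite measure `P` on positions satisfies
`c vol(S) ≤ P{reprSym (xᵢ − xⱼ) ∈ ε S}` for all measurable `S` in the shell `1 < ‖q‖ ≤ 1 + δ`, `2Lκ ≤ δ`, and the
measurable mark `Ξ ≥ 0` (bounded) vanishes at relative speed `≥ 2L`, then for all velocities `v, v'`:
`c κ Θ Ξ v v' ≤ ∫ tubeMark κ Ξ (ε⁻¹ reprSym (xᵢ − xⱼ)) v v' dP`. [folklore] -/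
theorem integral_tubeMark_ge {n : ℕ} (P : Measure (Fin n → T3)) [IsFiniteMeasure P]
    {ε : ℝ} (hε : 0 < ε) (i j : Fin n) {Ξ : V3 × V3 × V3 → ℝ} (hΞm : Measurable Ξ) {C : ℝ}
    (hΞC : ∀ p, |Ξ p| ≤ C) (hΞ0 : ∀ p, 0 ≤ Ξ p) {L κ δ c : ℝ} (hκ : 0 ≤ κ) (hLκδ : 2 * L * κ ≤ δ)
    (hΞL : ∀ m v v' : V3, 2 * L ≤ ‖v - v'‖ → Ξ (m, v, v') = 0)
    (hC : ∀ S : Set V3, MeasurableSet S → S ⊆ {q | 1 < ‖q‖ ∧ ‖q‖ ≤ 1 + δ} →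
      c * (volume : Measure V3).real S ≤ P.real {x | Torus.reprSym (x i - x j) ∈ ε • S})
    (v v' : V3) :
    c * κ * sphereMark Ξ v v' ≤ ∫ x, tubeMark κ Ξ (ε⁻¹ • Torus.reprSym (x i - x j)) v v' ∂P := by
  set w := v - v' with hw
  by_cases hwL : ‖w‖ < 2 * L
  · -- the strict tube and the reduced mark
    set T := strictTube κ w with hT
    have hTm : MeasurableSet T := measurableSet_strictTube κ w
    set h : V3 → ℝ := fun q => Ξ (impactNormal w q, v, v') with hh
    have hhm : Measurable h := hΞm.comp ((measurable_impactNormal w).prodMk measurable_const)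
    have hh0 : ∀ q, 0 ≤ h q := fun q => hΞ0 _
    have hhB : ∀ q, h q ≤ C := fun q => (le_abs_self _).trans (hΞC _)
    have hind : (fun q => tubeMark κ Ξ q v v') = T.indicator h := tubeMark_eq_indicator κ Ξ v v'
    -- the law of the rescaled separation
    set ν : Measure V3 := P.map fun x => ε⁻¹ • Torus.reprSym (x i - x j) with hν
    haveI : IsFiniteMeasure ν := by rw [hν]; infer_instance
    have hI : ∫ x, tubeMark κ Ξ (ε⁻¹ • Torus.reprSym (x i - x j)) v v' ∂P = ∫ q in T, h q ∂ν := by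
      rw [← integral_indicator hTm, ← hind, hν,
        integral_map (measurable_sep ε i j).aemeasurable (measurable_tubeMark_left κ hΞm _ _).aestronglyMeasurable]
    have hLeb : ∫ q in T, h q = κ * sphereMark Ξ v v' := by
      rw [← integral_indicator hTm, ← hind, integral_tubeMark_eq_mul_sphereMark hκ hΞm]
    -- the tube lies in the shell
    have hTsub : T ⊆ {q : V3 | 1 < ‖q‖ ∧ ‖q‖ ≤ 1 + δ} := fun q hq => by
      obtain ⟨h1, h2⟩ := strictTube_subset_shell κ w hq
      refine ⟨h1, h2.trans ?_⟩
      have : κ * ‖w‖ ≤ κ * (2 * L) := mul_le_mul_of_nonneg_left hwL.le hκ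
      linarith
    -- the hypothesis, transported to `ν`
    have hCS : ∀ S, MeasurableSet S → S ⊆ T → c * (volume : Measure V3).real S ≤ ν.real S := by
      intro S hS hST
      have hconv : ν.real S = P.real {x | Torus.reprSym (x i - x j) ∈ ε • S} := by
        rw [measureReal_def, measureReal_def, hν, Measure.map_apply (measurable_sep ε i j) hS]
        congr 1
        congr 1
        ext x
        simp only [mem_preimage, mem_setOf_eq, mem_smul_set_iff_inv_smul_mem₀ hε.ne']
      rw [hconv]
      exact hC S hS (hST.trans hTsub)
    have hfinν : ν T ≠ ∞ := measure_ne_top _ _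
    have hfinμ : (volume : Measure V3) T ≠ ∞ := by
      haveI := isFiniteMeasure_sphereMeasure (E := V3)
      refine ((measure_strictTube_le (volume : Measure V3) hκ w).trans_lt ?_).ne
      exact ENNReal.mul_lt_top ENNReal.ofReal_lt_top (measure_lt_top _ _)
    have hM := mul_setIntegral_le_setIntegral_of_forall_le hTm hfinν hfinμ hCS hhm hh0 hhB
    rw [hI]
    rw [hLeb] at hM
    calc c * κ * sphereMark Ξ v v' = c * (κ * sphereMark Ξ v v') := by ring
      _ ≤ ∫ q in T, h q ∂ν := hM
  · -- large relative speed: the mark vanishes identically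
    push Not at hwL
    have hΞ0' : ∀ m : V3, Ξ (m, v, v') = 0 := fun m => hΞL m v v' hwL
    have h0 : ∀ x : Fin n → T3, tubeMark κ Ξ (ε⁻¹ • Torus.reprSym (x i - x j)) v v' = 0 := fun x => by
      simp only [tubeMark, hΞ0', ite_self]
    have hΘ0 : sphereMark Ξ v v' = 0 := by
      simp only [sphereMark, hΞ0', zero_mul, integral_zero]
    simp only [h0, integral_zero, hΘ0, mul_zero, le_refl]

/-! ## The canonical pair law just outside contact dominates `(1 − 16λ) ε³ ·` Lebesgue -/

/-- **The canonical rescaled pair law dominates `(1 − 16λ) ε³` times Lebesgue measure on thin shells.**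
Under `SmallDensity uniformProfile σ`, for `i ≠ j`, `ε_N (1 + δ) < 1/2` and measurable `S ⊆ {1 < ‖q‖ ≤ 1 + δ}`:
`(1 − 16λ) ε_N³ vol(S) ≤ P_N {reprSym (xᵢ − xⱼ) ∈ ε_N S}`, `λ = v₁σ³` (`posGibbs_pairEvent_ge` for the torus
event `{ε⁻¹ reprSym (xᵢ − xⱼ) ∈ S}`, whose Haar measure is `ε³ vol(S)` because `reprSym` is measure preserving
onto the symmetric cube and `ε S` lies in the ball of radius `ε(1 + δ) < 1/2`). [folklore] -/
theorem posGibbs_rescaledPairEvent_ge {σ : ℝ} (hsd : SmallDensity uniformProfile σ) {N : ℕ}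
    {i j : Fin (N + 1)} (hij : i ≠ j) {δ : ℝ} (hδ : hsDiameter σ N * (1 + δ) < 1 / 2)
    {S : Set V3} (hS : MeasurableSet S) (hSsub : S ⊆ {q | 1 < ‖q‖ ∧ ‖q‖ ≤ 1 + δ}) :
    (1 - 16 * ovDensity uniformProfile σ) * (hsDiameter σ N ^ 3 * (volume : Measure V3).real S) ≤
      (posGibbsMeasure (fun _ : T3 => (1 : ℝ)) (hsDiameter σ N) (N + 1)).real
        {x | Torus.reprSym (x i - x j) ∈ hsDiameter σ N • S} := by
  set ε := hsDiameter σ N with hεdef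
  have hσ := hsd.σ_pos
  have hε : 0 < ε := hsDiameter_pos hσ N
  haveI hPprob : IsProbabilityMeasure (posGibbsMeasure (fun _ : T3 => (1 : ℝ)) ε (N + 1)) :=
    isProbabilityMeasure_posGibbsMeasure continuous_const (fun _ => one_pos) hsd.σ_lt_half.le N
  -- the torus event `T = {q | ε⁻¹ reprSym q ∈ S}`
  set T : Set T3 := {q | ε⁻¹ • Torus.reprSym q ∈ S} with hTdef
  have hsepq : Measurable fun q : T3 => ε⁻¹ • Torus.reprSym q := Torus.measurable_reprSym.const_smul ε⁻¹
  have hT : MeasurableSet T := hsepq hS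
  have hTfar : ∀ q ∈ T, ε ≤ ‖Torus.reprSym q‖ := by
    intro q hq
    have h1 : 1 < ‖ε⁻¹ • Torus.reprSym q‖ := (hSsub hq).1
    rw [norm_smul, norm_inv, Real.norm_of_nonneg hε.le] at h1
    have h2 : ε * 1 < ε * (ε⁻¹ * ‖Torus.reprSym q‖) := mul_lt_mul_of_pos_left h1 hε
    rw [mul_one, ← mul_assoc, mul_inv_cancel₀ hε.ne', one_mul] at h2
    exact h2.le
  have hevent : {x : Fin (N + 1) → T3 | x i - x j ∈ T} = {x | Torus.reprSym (x i - x j) ∈ ε • S} := by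
    ext x
    simp only [hTdef, mem_setOf_eq, mem_smul_set_iff_inv_smul_mem₀ hε.ne']
  -- the Haar measure of `T` is `ε³ vol S`
  have hvolT : volume T = ENNReal.ofReal (ε ^ 3) * volume S := by
    have hB : MeasurableSet ((fun y : V3 => ε⁻¹ • y) ⁻¹' S) := (measurable_const_smul ε⁻¹) hS
    have h1 : T = {q : T3 | Torus.reprSym (q - 0) ∈ (fun y : V3 => ε⁻¹ • y) ⁻¹' S} := by
      ext q
      simp only [hTdef, mem_setOf_eq, sub_zero, mem_preimage]
    have hsub : (fun y : V3 => ε⁻¹ • y) ⁻¹' S ⊆ Torus.symCube (Fin 3) := by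
      intro y hy
      refine Torus.closedBall_subset_symCube hδ ?_
      have h2 : ‖ε⁻¹ • y‖ ≤ 1 + δ := (hSsub hy).2
      rw [norm_smul, norm_inv, Real.norm_of_nonneg hε.le, inv_mul_le_iff₀ hε] at h2
      rw [Metric.mem_closedBall, dist_zero_right]
      exact h2
    rw [h1, Torus.volume_reprSym_sub_mem (0 : T3) hB, inter_eq_left.2 hsub, Set.preimage_smul_inv₀ hε.ne',
      Measure.addHaar_smul, finrank_euclideanSpace_fin, abs_of_pos (pow_pos hε 3)]
  -- p97748: the lower bound for the torus event
  have hmain := posGibbs_pairEvent_ge hsd hij hT hTfar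
  rw [hevent, hvolT] at hmain
  -- finiteness of `vol S`
  have hSfin : volume S ≠ ∞ := by
    refine ((measure_mono fun q hq => ?_).trans_lt
      (measure_closedBall_lt_top (x := (0 : V3)) (r := 1 + δ))).ne
    rw [Metric.mem_closedBall, dist_zero_right]
    exact (hSsub hq).2
  -- pass to real numbers
  by_cases hpos : 1 - 16 * ovDensity uniformProfile σ ≤ 0
  · exact (mul_nonpos_of_nonpos_of_nonneg hpos (by positivity)).trans measureReal_nonneg
  push Not at hpos
  have hfin : ENNReal.ofReal (1 - 16 * ovDensity uniformProfile σ) * (ENNReal.ofReal (ε ^ 3) * volume S) ≠ ∞ :=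
    ENNReal.mul_ne_top ENNReal.ofReal_ne_top (ENNReal.mul_ne_top ENNReal.ofReal_ne_top hSfin)
  have h := ENNReal.toReal_mono (measure_ne_top _ _) hmain
  rw [ENNReal.toReal_mul, ENNReal.toReal_mul, ENNReal.toReal_ofReal hpos.le,
    ENNReal.toReal_ofReal (by positivity)] at h
  rw [measureReal_def]
  exact h

/-! ## The pair-level tube mean: lower bound -/

/-- **One ordered pair has at least `(1 − 16λ)` times the ideal tube mean at rung 0, for every nonnegative
mark with a speed cutoff** (no contact theorem).  For constant profiles `a, θ > 0`, `u`,
`SmallDensity uniformProfile σ`, `i ≠ j`, continuous `χ ≥ 0`, a continuous mark `0 ≤ Ξ ≤ C` vanishing at relative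
speed `‖v − v'‖ ≥ 2L` (`L ≥ 0`), `κ ≥ 0` with `ε_N (1 + 2Lκ) < 1/2`:
`(∫ χ) · (1 − 16λ) ε_N³ κ Θ̄_Ξ ≤ E_{G_N}[χ(xᵢ) · tubeMark κ Ξ (ε⁻¹ sepVec xᵢ xⱼ) vᵢ vⱼ]`,
`Θ̄_Ξ = ∫∫ Θ Ξ (v, v') M(v) M(v') dv dv'`. [folklore] -/
theorem pair_tubeMark_mean_ge {σ a θ : ℝ} {u : V3} {N : ℕ}
    (Φ : HardSphereFlow (Torus.geometry (Fin 3)) (hsDiameter σ N) (N + 1))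
    {i j : Fin (N + 1)} (hij : i ≠ j) (hsd : SmallDensity uniformProfile σ) (ha : 0 < a) (hθ : 0 < θ)
    {χ : T3 → ℝ} (hχ : Continuous χ) (hχ0 : ∀ y, 0 ≤ χ y)
    {Ξ : V3 × V3 × V3 → ℝ} (hΞc : Continuous Ξ) {C : ℝ} (hΞC : ∀ p, |Ξ p| ≤ C) (hΞ0 : ∀ p, 0 ≤ Ξ p)
    {L κ : ℝ} (hL : 0 ≤ L) (hκ : 0 ≤ κ) (hΞL : ∀ m v v' : V3, 2 * L ≤ ‖v - v'‖ → Ξ (m, v, v') = 0)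
    (hsmall : hsDiameter σ N * (1 + 2 * L * κ) < 1 / 2) :
    (∫ y, χ y) * ((1 - 16 * ovDensity uniformProfile σ) * hsDiameter σ N ^ 3 * κ *
        ∫ p : V3 × V3, sphereMark Ξ p.1 p.2 * (localMaxwellian 1 θ u p.1 * localMaxwellian 1 θ u p.2)) ≤
      ∫ z, χ (z i).1 * pairTubeMark (hsDiameter σ N) κ Ξ i j (fun m => (z m).1) (fun m => (z m).2)
        ∂(localGibbsLaw σ (fun _ => a) (fun _ => u) (fun _ => θ) N Φ) := by
  have hσ := hsd.σ_pos
  have hσ2 : σ ≤ 1 / 2 := hsd.σ_lt_half.le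
  have hε : 0 < hsDiameter σ N := hsDiameter_pos hσ N
  have hΞm : Measurable Ξ := hΞc.measurable
  haveI hPprob : IsProbabilityMeasure (posGibbsMeasure (fun _ : T3 => a) (hsDiameter σ N) (N + 1)) :=
    isProbabilityMeasure_posGibbsMeasure continuous_const (fun _ => ha) hσ2 N
  have hC0 : 0 ≤ C := (abs_nonneg _).trans (hΞC (0, 0, 0))
  have hφb : ∀ x v, |pairTubeMark (hsDiameter σ N) κ Ξ i j x v| ≤ C :=
    abs_pairTubeMark_le _ _ hΞC i j
  -- the disintegration
  rw [integral_localGibbsLaw_mul_shiftInvariant Φ hσ2 ha hθ hχ i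
    (measurable_pairTubeMark (hsDiameter σ N) κ hΞm i j) hφb
    (pairTubeMark_add_const (hsDiameter σ N) κ Ξ i j)]
  -- the configurational lower bound for the pair (activity `a` = activity `1`)
  set c : ℝ := (1 - 16 * ovDensity uniformProfile σ) * hsDiameter σ N ^ 3 with hcdef
  have hCP : ∀ S : Set V3, MeasurableSet S → S ⊆ {q | 1 < ‖q‖ ∧ ‖q‖ ≤ 1 + 2 * L * κ} →
      c * (volume : Measure V3).real S ≤
        (posGibbsMeasure (fun _ : T3 => a) (hsDiameter σ N) (N + 1)).real
          {x | Torus.reprSym (x i - x j) ∈ hsDiameter σ N • S} := by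
    intro S hS hSsub
    rw [posGibbsMeasure_const_eq_one ha]
    have h := posGibbs_rescaledPairEvent_ge hsd hij hsmall hS hSsub
    rwa [← mul_assoc] at h
  -- the position average for fixed velocities
  have key : ∀ v : Fin (N + 1) → V3, c * κ * sphereMark Ξ (v i) (v j) ≤
      ∫ x, pairTubeMark (hsDiameter σ N) κ Ξ i j x v ∂posGibbsMeasure (fun _ : T3 => a) (hsDiameter σ N) (N + 1) :=
    fun v => integral_tubeMark_ge (posGibbsMeasure (fun _ : T3 => a) (hsDiameter σ N) (N + 1)) hε i j hΞm hΞC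
      hΞ0 hκ le_rfl hΞL hCP (v i) (v j)
  -- the velocity average
  have hΘm : Measurable fun p : V3 × V3 => sphereMark Ξ p.1 p.2 := measurable_sphereMark hΞc
  have hpair : ∫ v, sphereMark Ξ (v i) (v j) ∂Measure.pi (fun _ : Fin (N + 1) => gaussMeasure u θ) =
      ∫ p : V3 × V3, sphereMark Ξ p.1 p.2 * (localMaxwellian 1 θ u p.1 * localMaxwellian 1 θ u p.2) :=
    integral_pi_pair_gauss hθ u hij (f := fun p : V3 × V3 => sphereMark Ξ p.1 p.2) hΘm
  have hsw : StronglyMeasurable (uncurry fun (v : Fin (N + 1) → V3) (x : Fin (N + 1) → T3) =>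
      pairTubeMark (hsDiameter σ N) κ Ξ i j x v) := by
    have h := ((measurable_pairTubeMark (hsDiameter σ N) κ hΞm i j).comp measurable_swap).stronglyMeasurable
    exact h
  have hIm : Measurable fun v : Fin (N + 1) → V3 =>
      ∫ x, pairTubeMark (hsDiameter σ N) κ Ξ i j x v ∂posGibbsMeasure (fun _ : T3 => a) (hsDiameter σ N) (N + 1) :=
    hsw.integral_prod_right'.measurable
  have hIint : Integrable (fun v : Fin (N + 1) → V3 =>
      ∫ x, pairTubeMark (hsDiameter σ N) κ Ξ i j x v ∂posGibbsMeasure (fun _ : T3 => a) (hsDiameter σ N) (N + 1))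
      (Measure.pi fun _ : Fin (N + 1) => gaussMeasure u θ) := by
    refine Integrable.of_bound hIm.aestronglyMeasurable C (ae_of_all _ fun v => ?_)
    have h := norm_integral_le_of_norm_le_const
      (μ := posGibbsMeasure (fun _ : T3 => a) (hsDiameter σ N) (N + 1))
      (f := fun x => pairTubeMark (hsDiameter σ N) κ Ξ i j x v) (C := C)
      (ae_of_all _ fun x => by rw [Real.norm_eq_abs]; exact hφb x v)
    simpa only [probReal_univ, mul_one] using h
  have hvij : Measurable fun v : Fin (N + 1) → V3 => (v i, v j) :=
    (measurable_pi_apply i).prodMk (measurable_pi_apply j)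
  have hΘint : Integrable (fun v : Fin (N + 1) → V3 => c * κ * sphereMark Ξ (v i) (v j))
      (Measure.pi fun _ : Fin (N + 1) => gaussMeasure u θ) := by
    have hm := (hΘm.comp hvij).const_mul (c * κ)
    refine Integrable.of_bound hm.aestronglyMeasurable
      (|c * κ| * (C * (2 * L) * (sphereMeasure : Measure (Metric.sphere (0 : V3) 1)).real univ))
      (ae_of_all _ fun v => ?_)
    rw [Real.norm_eq_abs, abs_mul]
    exact mul_le_mul_of_nonneg_left (abs_sphereMark_le_of_speedCutoff hΞC hL hΞL _ _) (abs_nonneg _)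
  have hmono : ∫ v, c * κ * sphereMark Ξ (v i) (v j) ∂Measure.pi (fun _ : Fin (N + 1) => gaussMeasure u θ) ≤
      ∫ v, ∫ x, pairTubeMark (hsDiameter σ N) κ Ξ i j x v ∂posGibbsMeasure (fun _ : T3 => a) (hsDiameter σ N) (N + 1)
        ∂Measure.pi (fun _ : Fin (N + 1) => gaussMeasure u θ) :=
    integral_mono hΘint hIint key
  rw [integral_const_mul, hpair] at hmono
  have hχI : 0 ≤ ∫ y, χ y := integral_nonneg hχ0
  calc (∫ y, χ y) * ((1 - 16 * ovDensity uniformProfile σ) * hsDiameter σ N ^ 3 * κ *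
          ∫ p : V3 × V3, sphereMark Ξ p.1 p.2 * (localMaxwellian 1 θ u p.1 * localMaxwellian 1 θ u p.2))
      = (∫ y, χ y) * (c * κ *
          ∫ p : V3 × V3, sphereMark Ξ p.1 p.2 * (localMaxwellian 1 θ u p.1 * localMaxwellian 1 θ u p.2)) := by
        rw [hcdef]
    _ ≤ (∫ y, χ y) * ∫ v, ∫ x, pairTubeMark (hsDiameter σ N) κ Ξ i j x v
          ∂posGibbsMeasure (fun _ : T3 => a) (hsDiameter σ N) (N + 1)
          ∂Measure.pi (fun _ : Fin (N + 1) => gaussMeasure u θ) := mul_le_mul_of_nonneg_left hmono hχI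

/-! ## The tube double sum over ordered pairs: lower bound for its Gibbs mean -/

/-- **The Gibbs mean of the collision-cylinder double sum is at least `(1 − 16λ)` times the ideal one.**
Summing `pair_tubeMark_mean_ge` over the `(N+1)N` ordered pairs:
`(N+1) N (∫χ) (1 − 16λ) ε_N³ κ Θ̄_Ξ ≤ E_{G_N}[Σᵢ Σⱼ [i ≠ j] χ(xᵢ) pairTubeMark ε_N κ Ξ i j]`. [folklore] -/
theorem sum_pair_tubeMark_mean_ge {σ a θ : ℝ} {u : V3} {N : ℕ}
    (Φ : HardSphereFlow (Torus.geometry (Fin 3)) (hsDiameter σ N) (N + 1))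
    (hsd : SmallDensity uniformProfile σ) (ha : 0 < a) (hθ : 0 < θ)
    {χ : T3 → ℝ} (hχ : Continuous χ) (hχ0 : ∀ y, 0 ≤ χ y)
    {Ξ : V3 × V3 × V3 → ℝ} (hΞc : Continuous Ξ) {C : ℝ} (hΞC : ∀ p, |Ξ p| ≤ C) (hΞ0 : ∀ p, 0 ≤ Ξ p)
    {L κ : ℝ} (hL : 0 ≤ L) (hκ : 0 ≤ κ) (hΞL : ∀ m v v' : V3, 2 * L ≤ ‖v - v'‖ → Ξ (m, v, v') = 0)
    (hsmall : hsDiameter σ N * (1 + 2 * L * κ) < 1 / 2) :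
    ((N + 1 : ℕ) : ℝ) * N * ((∫ y, χ y) * ((1 - 16 * ovDensity uniformProfile σ) * hsDiameter σ N ^ 3 * κ *
        ∫ p : V3 × V3, sphereMark Ξ p.1 p.2 * (localMaxwellian 1 θ u p.1 * localMaxwellian 1 θ u p.2))) ≤
      ∫ z, ∑ i : Fin (N + 1), ∑ j : Fin (N + 1),
          (if i ≠ j then χ (z i).1 * pairTubeMark (hsDiameter σ N) κ Ξ i j (fun m => (z m).1) (fun m => (z m).2)
            else 0)
        ∂(localGibbsLaw σ (fun _ => a) (fun _ => u) (fun _ => θ) N Φ) := by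
  have hσ := hsd.σ_pos
  have hσ2 : σ ≤ 1 / 2 := hsd.σ_lt_half.le
  have hΞm : Measurable Ξ := hΞc.measurable
  haveI hGprob : IsProbabilityMeasure (localGibbsLaw σ (fun _ => a) (fun _ => u) (fun _ => θ) N Φ) :=
    isProbabilityMeasure_localGibbsLaw continuous_const continuous_const continuous_const
      (fun _ => ha) (fun _ => hθ) hσ2 N Φ
  obtain ⟨Cχ, -, hCχ⟩ := exists_forall_abs_le_of_continuous hχ
  have hCχ0 : 0 ≤ Cχ := (abs_nonneg _).trans (hCχ 0)
  set G := localGibbsLaw σ (fun _ => a) (fun _ => u) (fun _ => θ) N Φ with hGdef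
  set b : ℝ := (∫ y, χ y) * ((1 - 16 * ovDensity uniformProfile σ) * hsDiameter σ N ^ 3 * κ *
    ∫ p : V3 × V3, sphereMark Ξ p.1 p.2 * (localMaxwellian 1 θ u p.1 * localMaxwellian 1 θ u p.2)) with hbdef
  -- the summands
  set S1 : Fin (N + 1) → Fin (N + 1) → Config (N + 1) (Fin 3) T3 → ℝ := fun i j z =>
    if i ≠ j then χ (z i).1 * pairTubeMark (hsDiameter σ N) κ Ξ i j (fun m => (z m).1) (fun m => (z m).2)
      else 0 with hS1def
  have hχim : ∀ i : Fin (N + 1), Measurable fun z : Config (N + 1) (Fin 3) T3 => χ (z i).1 := fun i => by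
    have h0 : Measurable fun z : Config (N + 1) (Fin 3) T3 => (z i).1 := (measurable_pi_apply i).fst
    have h := hχ.measurable.comp h0
    exact h
  have hS1m : ∀ i j, Measurable (S1 i j) := fun i j =>
    Measurable.ite (MeasurableSet.const _) ((hχim i).mul (measurable_pairTubeMark_config (hsDiameter σ N) κ hΞm i j))
      measurable_const
  have hS1b : ∀ i j z, |S1 i j z| ≤ Cχ * C := fun i j z => by
    simp only [hS1def]
    split_ifs
    · rw [abs_mul]
      exact mul_le_mul (hCχ _) (abs_pairTubeMark_le _ _ hΞC i j _ _) (abs_nonneg _) hCχ0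
    · rw [abs_zero]; exact mul_nonneg hCχ0 ((abs_nonneg _).trans (hΞC (0, 0, 0)))
  have hS1i : ∀ i j, Integrable (S1 i j) G := fun i j =>
    Integrable.of_bound (hS1m i j).aestronglyMeasurable _ (ae_of_all _ fun z => by
      rw [Real.norm_eq_abs]; exact hS1b i j z)
  -- linearity
  have hI : ∫ z, ∑ i, ∑ j, S1 i j z ∂G = ∑ i, ∑ j, ∫ z, S1 i j z ∂G := by
    rw [integral_finsetSum _ fun i _ => integrable_finsetSum _ fun j _ => hS1i i j]
    exact Finset.sum_congr rfl fun i _ => integral_finsetSum _ fun j _ => hS1i i j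
  -- pair by pair
  have hpair : ∀ i j : Fin (N + 1), (if i ≠ j then b else 0) ≤ ∫ z, S1 i j z ∂G := by
    intro i j
    by_cases hij : i ≠ j
    · rw [if_pos hij]
      have hm := pair_tubeMark_mean_ge (u := u) Φ hij hsd ha hθ hχ hχ0 hΞc hΞC hΞ0 hL hκ hΞL hsmall
      have hS1 : ∫ z, S1 i j z ∂G =
          ∫ z, χ (z i).1 * pairTubeMark (hsDiameter σ N) κ Ξ i j (fun m => (z m).1) (fun m => (z m).2) ∂G :=
        integral_congr_ae (ae_of_all _ fun z => by simp only [hS1def, if_pos hij])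
      rw [hS1, hbdef]
      exact hm
    · rw [if_neg hij]
      have h0 : ∫ z, S1 i j z ∂G = 0 := by simp only [hS1def, if_neg hij, integral_zero]
      rw [h0]
  show ((N + 1 : ℕ) : ℝ) * N * b ≤ ∫ z, ∑ i, ∑ j, S1 i j z ∂G
  rw [hI, ← sum_sum_ite_ne_const N b]
  exact Finset.sum_le_sum fun i _ => Finset.sum_le_sum fun j _ => hpair i j

/-- **Normalised form**: with the weight `((N+1)κ)⁻¹` of the collision-tube functional (`κ > 0`) and
`(N+1) ε_N³ = σ³`, the Gibbs mean of the normalised collision-cylinder double sum is at least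
`(1 − 16λ) (N/(N+1)) σ³ (∫χ) Θ̄_Ξ` — a universal fraction of the ideal-gas collision rate, uniformly in `N ≥ 1`.
[folklore] -/
theorem normalised_sum_pair_tubeMark_mean_ge {σ a θ : ℝ} {u : V3} {N : ℕ}
    (Φ : HardSphereFlow (Torus.geometry (Fin 3)) (hsDiameter σ N) (N + 1))
    (hsd : SmallDensity uniformProfile σ) (ha : 0 < a) (hθ : 0 < θ)
    {χ : T3 → ℝ} (hχ : Continuous χ) (hχ0 : ∀ y, 0 ≤ χ y)
    {Ξ : V3 × V3 × V3 → ℝ} (hΞc : Continuous Ξ) {C : ℝ} (hΞC : ∀ p, |Ξ p| ≤ C) (hΞ0 : ∀ p, 0 ≤ Ξ p)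
    {L κ : ℝ} (hL : 0 ≤ L) (hκ : 0 < κ) (hΞL : ∀ m v v' : V3, 2 * L ≤ ‖v - v'‖ → Ξ (m, v, v') = 0)
    (hsmall : hsDiameter σ N * (1 + 2 * L * κ) < 1 / 2) :
    (N : ℝ) / (N + 1 : ℝ) * ((1 - 16 * ovDensity uniformProfile σ) * σ ^ 3 * ((∫ y, χ y) *
        ∫ p : V3 × V3, sphereMark Ξ p.1 p.2 * (localMaxwellian 1 θ u p.1 * localMaxwellian 1 θ u p.2))) ≤
      ∫ z, ((N + 1 : ℝ) * κ)⁻¹ * ∑ i : Fin (N + 1), ∑ j : Fin (N + 1),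
          (if i ≠ j then χ (z i).1 * pairTubeMark (hsDiameter σ N) κ Ξ i j (fun m => (z m).1) (fun m => (z m).2)
            else 0)
        ∂(localGibbsLaw σ (fun _ => a) (fun _ => u) (fun _ => θ) N Φ) := by
  have h := sum_pair_tubeMark_mean_ge (u := u) Φ hsd ha hθ hχ hχ0 hΞc hΞC hΞ0 hL hκ.le hΞL hsmall
  have hnε : ((N + 1 : ℕ) : ℝ) * hsDiameter σ N ^ 3 = σ ^ 3 := succ_mul_hsDiameter_pow_three σ N
  have hn1 : ((N + 1 : ℕ) : ℝ) = (N + 1 : ℝ) := by push_cast; ring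
  rw [hn1] at hnε h
  have hn0 : (0 : ℝ) < (N + 1 : ℝ) := by positivity
  have hnκ : 0 < ((N + 1 : ℝ) * κ)⁻¹ := by positivity
  rw [integral_const_mul]
  have h2 := mul_le_mul_of_nonneg_left h hnκ.le
  refine le_trans (le_of_eq ?_) h2
  set I : ℝ := ∫ y, χ y with hI
  set Θ : ℝ := ∫ p : V3 × V3, sphereMark Ξ p.1 p.2 * (localMaxwellian 1 θ u p.1 * localMaxwellian 1 θ u p.2) with hΘ
  set lam : ℝ := ovDensity uniformProfile σ with hlam
  set ε : ℝ := hsDiameter σ N with hε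
  rw [← hnε]
  field_simp

/-- **In the crux's parametrisation: the pair tube mean is at least HALF the ideal one.**  There is
`σ₀ > 0` such that for `0 < σ < σ₀`, all constant profiles `a, θ > 0`, `u`, all `N`, flows, `i ≠ j`,
continuous `χ ≥ 0`, continuous marks `0 ≤ Ξ ≤ C` vanishing at relative speed `≥ 2L` (`L ≥ 0`), and `κ ≥ 0`
with `σ(1 + 2Lκ) < 1/2`:
`(∫χ) ε_N³ κ Θ̄_Ξ ≤ 2 E_{G_N}[χ(xᵢ) pairTubeMark ε_N κ Ξ i j]`. [folklore] -/
theorem exists_pair_tubeMark_mean_ge_half :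
    ∃ σ₀ : ℝ, 0 < σ₀ ∧ ∀ σ : ℝ, 0 < σ → σ < σ₀ → ∀ (a θ : ℝ) (u : V3), 0 < a → 0 < θ → ∀ (N : ℕ)
      (Φ : HardSphereFlow (Torus.geometry (Fin 3)) (hsDiameter σ N) (N + 1)) (i j : Fin (N + 1)), i ≠ j →
      ∀ χ : T3 → ℝ, Continuous χ → (∀ y, 0 ≤ χ y) →
      ∀ Ξ : V3 × V3 × V3 → ℝ, Continuous Ξ → (∀ q, 0 ≤ Ξ q) → (∃ C : ℝ, ∀ q, |Ξ q| ≤ C) →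
      ∀ L κ : ℝ, 0 ≤ L → 0 ≤ κ → (∀ m v v' : V3, 2 * L ≤ ‖v - v'‖ → Ξ (m, v, v') = 0) →
      σ * (1 + 2 * L * κ) < 1 / 2 →
      (∫ y, χ y) * (hsDiameter σ N ^ 3 * κ *
          ∫ p : V3 × V3, sphereMark Ξ p.1 p.2 * (localMaxwellian 1 θ u p.1 * localMaxwellian 1 θ u p.2)) ≤
        2 * ∫ z, χ (z i).1 * pairTubeMark (hsDiameter σ N) κ Ξ i j (fun m => (z m).1) (fun m => (z m).2)
          ∂(localGibbsLaw σ (fun _ => a) (fun _ => u) (fun _ => θ) N Φ) := by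
  obtain ⟨σ₁, hσ₁, hsmall⟩ := exists_smallDensity uniformProfile one_pos
  -- also make `16 λ ≤ 1/2`, i.e. `v₁ σ³ < 1/32`
  have hcont : Filter.Tendsto (fun σ : ℝ => ovDensity uniformProfile σ) (nhds 0) (nhds 0) := by
    have hc : Continuous fun σ : ℝ => ovDensity uniformProfile σ := by unfold ovDensity; fun_prop
    simpa [ovDensity] using hc.tendsto 0
  have hev : ∀ᶠ σ in nhds (0 : ℝ), ovDensity uniformProfile σ < 1 / 32 :=
    hcont (Iio_mem_nhds (by norm_num : (0 : ℝ) < 1 / 32))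
  obtain ⟨σ₂, hσ₂, hσ₂prop⟩ : ∃ σ₂ > 0, ∀ σ : ℝ, |σ| < σ₂ → ovDensity uniformProfile σ < 1 / 32 := by
    rcases Metric.eventually_nhds_iff.1 hev with ⟨δ, hδ, hδprop⟩
    exact ⟨δ, hδ, fun σ hσ => hδprop (by simpa [Real.dist_eq] using hσ)⟩
  refine ⟨min σ₁ σ₂, lt_min hσ₁ hσ₂, ?_⟩
  intro σ hσ hσlt a θ u ha hθ N Φ i j hij χ hχ hχ0 Ξ hΞc hΞ0 hΞC L κ hL hκ hΞL hLκ
  obtain ⟨C, hC⟩ := hΞC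
  have hsd : SmallDensity uniformProfile σ := (hsmall σ hσ (hσlt.trans_le (min_le_left _ _))).1
  have hlam : ovDensity uniformProfile σ < 1 / 32 :=
    hσ₂prop σ (by rw [abs_of_pos hσ]; exact hσlt.trans_le (min_le_right _ _))
  have hhalf : (1 : ℝ) / 2 ≤ 1 - 16 * ovDensity uniformProfile σ := by linarith
  -- `ε_N (1 + 2Lκ) ≤ σ (1 + 2Lκ) < 1/2`
  have hεsmall : hsDiameter σ N * (1 + 2 * L * κ) < 1 / 2 :=
    (mul_le_mul_of_nonneg_right (hsDiameter_le hσ.le N) (by positivity)).trans_lt hLκ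
  have hm := pair_tubeMark_mean_ge (u := u) Φ hij hsd ha hθ hχ hχ0 hΞc hC hΞ0 hL hκ hΞL hεsmall
  -- the ideal quantities are nonnegative
  have hΘ0 : 0 ≤ ∫ p : V3 × V3, sphereMark Ξ p.1 p.2 * (localMaxwellian 1 θ u p.1 * localMaxwellian 1 θ u p.2) :=
    integral_nonneg fun p => mul_nonneg (sphereMark_nonneg hΞ0 _ _)
      (mul_nonneg (localMaxwellian_nonneg zero_le_one hθ.le _ _) (localMaxwellian_nonneg zero_le_one hθ.le _ _))
  have hχI : 0 ≤ ∫ y, χ y := integral_nonneg hχ0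
  have hX : 0 ≤ (∫ y, χ y) * (hsDiameter σ N ^ 3 * κ *
      ∫ p : V3 × V3, sphereMark Ξ p.1 p.2 * (localMaxwellian 1 θ u p.1 * localMaxwellian 1 θ u p.2)) := by
    have : 0 ≤ hsDiameter σ N := hsDiameter_nonneg' hσ.le N
    positivity
  calc (∫ y, χ y) * (hsDiameter σ N ^ 3 * κ *
        ∫ p : V3 × V3, sphereMark Ξ p.1 p.2 * (localMaxwellian 1 θ u p.1 * localMaxwellian 1 θ u p.2))
      = 2 * ((∫ y, χ y) * ((1 / 2) * hsDiameter σ N ^ 3 * κ *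
        ∫ p : V3 × V3, sphereMark Ξ p.1 p.2 * (localMaxwellian 1 θ u p.1 * localMaxwellian 1 θ u p.2))) := by ring
    _ ≤ 2 * ((∫ y, χ y) * ((1 - 16 * ovDensity uniformProfile σ) * hsDiameter σ N ^ 3 * κ *
        ∫ p : V3 × V3, sphereMark Ξ p.1 p.2 * (localMaxwellian 1 θ u p.1 * localMaxwellian 1 θ u p.2))) := by
        have h3 : 0 ≤ hsDiameter σ N ^ 3 * κ *
            ∫ p : V3 × V3, sphereMark Ξ p.1 p.2 * (localMaxwellian 1 θ u p.1 * localMaxwellian 1 θ u p.2) := by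
          have : 0 ≤ hsDiameter σ N := hsDiameter_nonneg' hσ.le N
          positivity
        have h4 : (1 / 2) * hsDiameter σ N ^ 3 * κ *
            ∫ p : V3 × V3, sphereMark Ξ p.1 p.2 * (localMaxwellian 1 θ u p.1 * localMaxwellian 1 θ u p.2) ≤
            (1 - 16 * ovDensity uniformProfile σ) * hsDiameter σ N ^ 3 * κ *
            ∫ p : V3 × V3, sphereMark Ξ p.1 p.2 * (localMaxwellian 1 θ u p.1 * localMaxwellian 1 θ u p.2) := by
          have := mul_le_mul_of_nonneg_right hhalf h3
          simpa only [mul_assoc] using this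
        exact mul_le_mul_of_nonneg_left (mul_le_mul_of_nonneg_left h4 hχI) (by norm_num)
    _ ≤ 2 * ∫ z, χ (z i).1 * pairTubeMark (hsDiameter σ N) κ Ξ i j (fun m => (z m).1) (fun m => (z m).2)
          ∂(localGibbsLaw σ (fun _ => a) (fun _ => u) (fun _ => θ) N Φ) :=
        mul_le_mul_of_nonneg_left hm (by norm_num)

end Literature.MathematicalPhysics.KineticTheory

end
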